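import Summits.BirchSwinnertonDyer.Rank1Residual.X10.KatoMuTransferThreeOfCore
import Summits.BirchSwinnertonDyer.BirchSwinnertonDyer.Theorems.Rank1ResidualX9Defs
import HarnessLib

/-!
# The core of the `μ`-transfer, UNIFORMLY IN THE ODD PRIME: one typed node serving row A4 (X9,
# `p ≥ 5`) and row A5 (X10b = N2, `p = 3`) of rung K6, with kernel wrappers to BOTH registered
# shapes and the composition run once for every odd `p` (cell `b2b-bsdres`, unit `b2b-bsdres-x10` =
# N2 class lead, GEN 37; ONE typed node + theorems; nothing asserted, nothing booked)

HONEST FRAMING (run/shared/lean/b2b/bsd-rank1-residual/, verbatim in every file): the goal of the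
cell is to DELETE the COMBINATION-SHAPED residual classes of the Birch–Swinnerton-Dyer formula for
ALL analytic-rank `≤ 1` elliptic curves over `ℚ` — "full BSD formula for every rank `≤ 1` curve in
class `C`" assembled STRICTLY from published theorems — so that the rank-`≤ 1` remainder becomes
exactly the CONSTRUCTION-SHAPED classes, which are TYPED (missing-input `Prop`s), NOT attempted.
This is not "finishing BSD". Class X10b (N2) keeps its label CONSTRUCTION-SHAPED / NEEDS X_A3
(RESIDUAL-MAP §I N2); nothing is booked by this file; no census number moves.

## Why (x10 GEN 37, X10-AUDIT §43)

The deciding crux `MuTransferX9` (stmt-BirchSwinnertonDyer-19276, route `SmallImageMuTransfer`, cell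
`bsd-smallim`) carries the registered skeleton v4 (sha16 0154dd5daf38efd6): two PUBLISHED construction
facts (`stub_inputsX9`) and ONE open stub `stub_coreX9` — the core of Theorem A of MU-TRANSFER-PROOF
on genuine objects — hypothesised on `ClassX9 W p` (`¬CM ∧ 5 ≤ p ∧` good ordinary `∧ Irr ∧ ¬Surj`);
GEN 36 typed its `p = 3` twin `CoreTheoremAOnClassX10b`. AUDIT ("where does `3` enter"): in
MU-TRANSFER-PROOF §§1–5 the prime enters the IMAGE side only through (F2)/(F8) — a central scalar
`λ̄·1 ≠ 1` in `Ḡ = ρ̄_{E,p}(Γ_ℚ)` and "no quotient of order `p`" of `Ḡ^{ab}`, `Ḡ ∩ SL₂` — and every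
other step is stated for `p` odd (`C(q−1, 2) ≡ 0`, `−2 ≢ 0`, polarisation, Kato 12.4; memo §7 (ii)).
On `Irr ∧ ¬Surj` both image inputs are TREE THEOREMS: `p ∤ #Ḡ` at any prime (x9 GEN 41,
`not_dvd_card_range_galoisRepTorsion_of_irreducible_of_not_surjective`, Serre Prop. 15) and the
scalar at `5 ≤ p` / `p = 3` (`exists_galoisRepTorsion_eq_smul_of_not_surjective{,_three}`, koly);
every kernel step landed toward the core by `bsd-smallim` is in the `_of_irr_of_not_surj` any-prime
form. So the core is ONE statement on `{p odd} × {good ordinary, Irr, ¬Surj}`, typed here ONCE: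

* (image inputs, NOT here) the odd-prime forms of (F2)/(F8) are tree theorems of the K6 files:
  the central homothety inside `Gal(ℚ̄/ℚ_∞)` at every `p ≠ 2` (x9 GEN 42,
  `exists_mem_kerSubgroup_smul_eq_of_ne_two`, `…X9CentralScalarOdd`) and STEP 1
  "`im h = 𝒯_{J+1}(E)`" at every `p ≠ 2` (x10 GEN 37, `LevelE.valueSubgroup_ker_eq_top_of_ne_two`,
  `…X9StepOneSahOdd`, the `p ≠ 2` twin of k6-c2's `5 ≤ p` file) — the first places in the core
  where `p ≠ 2`, and not only `Irr ∧ ¬Surj`, is needed;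
* §1 — `CoreTheoremAOddPrime` (typed node, `@[conjecture]`, nothing asserted): `stub_coreX9` VERBATIM
  with `ClassX9 W p` replaced by `p ≠ 2`, good ordinary, `Irr`, `¬Surj`;
* §2 — KERNEL wrappers: the odd-prime core ⟹ the registered `stub_coreX9` statement verbatim
  (`coreTheoremA_classX9_of_oddPrime`) AND ⟹ `CoreTheoremAOnClassX10b` (`…OnClassX10b_of_oddPrime`);
* §3 — the registered composition `MuTransferX9_of` run ONCE for every odd `p`
  (`mu_eq_zero_of_coreOddPrime`), whence the crux statement of `MuTransferX9` on class X9 VERBATIM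
  (`muTransfer_classX9_of_coreOddPrime`), the N2 node `KatoMuTransferThree`
  (`katoMuTransferThree_of_coreOddPrime`) and the A5 chain (`…OnClassX10b_of_coreOddPrime`).

READING (evidence, no label moves): a kernel proof of `CoreTheoremAOddPrime` — what the cell
`bsd-smallim`'s any-prime lemmas assemble to — closes, by §2/§3, BOTH the deciding crux of rung K6
for A4 (through the registered composition) AND the open node of N2's per-pair and class-level
residue (GEN 35/36). Where `3` enters this file: nowhere — `p ≠ 2` throughout; `p = 3` only when
specialising to the N2 names.

References: [Kato2004Asterisque] Thm. 12.4, 12.6, (14.9.3), §17.13; [GreenbergVatsal2000] Prop. 3.7;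
[Serre1972] §2.4 Prop. 15, §2.6; [Sah1968] Prop. 2.7 (b); [Washington1997] §13.1; X10-AUDIT.md §41–§43;
HOME/pub/bsd-smallim/koly/MU-TRANSFER-PROOF.md (F2)/(F8), §7 (ii); plan/k6/lines/MuTransferX9_*v4*, CORE-PLAN S2.3.
-/

set_option autoImplicit false

noncomputable section

open scoped Classical MatrixGroups ModularForm NumberField
open CongruenceSubgroup WeierstrassCurve Field IsDedekindDomain
open Literature.NumberTheory.GaloisRepresentations
open Literature.NumberTheory.EllipticCurves Literature.NumberTheory.EllipticCurves.ModularForms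
open Literature.NumberTheory.EllipticCurves.Kato2004 Literature.NumberTheory.EllipticCurves.Kato2004.EulerSystemValues
open Literature.NumberTheory.EllipticCurves.Rank1Residual
open Summit.BirchSwinnertonDyer.BirchSwinnertonDyer.Theorems.Rank1ResidualX1Defs
  Summit.BirchSwinnertonDyer.BirchSwinnertonDyer.Rank1Residual

namespace Summit.BirchSwinnertonDyer.Rank1Residual.X10

/-! ### §1 The core of Theorem A, uniformly in the odd prime (typed node) -/

/-- **TYPED NODE — the CORE of Theorem A of MU-TRANSFER-PROOF (KOLY-MEMO Thm. 5.7.1) on GENUINE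
objects, UNIFORMLY IN THE ODD PRIME (OPEN; the cell theorem of `bsd-smallim` on paper; nothing
asserted).** For a globally minimal elliptic `W/ℚ`, a prime `p ≠ 2` of good ordinary reduction with
`E[p]` irreducible and `ρ̄_{E,p}` NOT surjective, the cyclotomic `(κ, γ)` and Kato's `𝐇¹_Γ(T_pW)`
(`I`): if some GENUINE `Λ`-adic Euler-system class `s ∈ 𝐇¹` is not divisible by `p`, then some
iterate `(conj_γ − id)^[J]` kills every `y ∈ H¹(ℚ_∞, E[p])` whose image in `H¹(ℚ_∞, E[p^∞])` lies in
`Sel₀(ℚ_∞, E[p^∞])`. VERBATIM the registered `stub_coreX9` of crux `MuTransferX9` (skeleton v4,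
sha16 0154dd5daf38efd6) with `ClassX9 W p` replaced by `p ≠ 2`, good ordinary, `Irr`, `¬Surj` — i.e.
GEN 36's `CoreTheoremAOnClassX10b` with `p = 3` replaced by `p ≠ 2`. Paper proof: MU-TRANSFER-PROOF
§§1–5 (`J = 2e − 1 + ε′`), image inputs (F2)/(F8) = tree theorems at every odd `p` (x9 GEN 42 / x10 GEN 37 K6
files `…CentralScalarOdd`, `…StepOneSahOdd`), all other steps stated for `p` odd (memo §7 (ii)). [cite: Kato2004Asterisque, Thm. 12.4, Thm. 12.6 (p. 222), §13.8 (p. 228) (shape only; nothing asserted)]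
[cite: GreenbergLNM1716, §1 Conj. 1.11 (shape only; nothing asserted)] -/
@[conjecture] def CoreTheoremAOddPrime : Prop :=
  ∀ (W : WeierstrassCurve ℚ) [W.IsElliptic] [W.IsGloballyMinimal] (p : ℕ) [Fact p.Prime]
    [ContinuousSMul ℤ_[p] (W.tateModule p)] [Module.Free ℤ_[p] (W.tateModule p)]
    [Module.Finite ℤ_[p] (W.tateModule p)]
    (κ : ZpExtension ℚ p) (γ : absoluteGaloisGroup ℚ) (I : IwasawaH1Data W p κ γ),
    p ≠ 2 → W.HasGoodReductionAtPrime p → ¬ (p : ℤ) ∣ W.frobeniusTrace p →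
    W.HasIrreducibleModPGaloisRep p → ¬ W.HasSurjectiveModNGaloisRep p →
    κ.IsCyclotomic → κ.IsTopGenerator γ →
    (∃ s : I.H, IsEulerSystemClass W p κ γ I s ∧
      s ∉ IwasawaAlgebra.augIdealP p • (⊤ : Submodule (IwasawaAlgebra p) I.H)) →
    ∃ J : ℕ, ∀ y : Literature.NumberTheory.EllipticCurves.subgroupH1 κ.kerSubgroup
        (WeierstrassCurve.geomTorsion W (p : ℤ)),
      W.torsionToPrimaryH1Sub p κ.kerSubgroup y ∈ W.fineSelmerInfty κ →
        (⇑(Literature.NumberTheory.EllipticCurves.conjH1 κ.kerSubgroup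
            (WeierstrassCurve.geomTorsion W (p : ℤ)) γ -
          AddMonoidHom.id (Literature.NumberTheory.EllipticCurves.subgroupH1 κ.kerSubgroup
            (WeierstrassCurve.geomTorsion W (p : ℤ)))))^[J] y = 0

/-! ### §2 The two registered shapes from the odd-prime core -/

/-- **`CoreTheoremAOddPrime ⟹ CoreTheoremAOnClassX10b`** (N2, `p = 3 ≠ 2`): GEN 36's node is the
`p = 3` specialisation. [cite: Kato2004Asterisque, Thm. 12.6 (p. 222) (shape only)] -/
theorem coreTheoremAOnClassX10b_of_oddPrime (h : CoreTheoremAOddPrime) : CoreTheoremAOnClassX10b := by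
  intro W _ _ p _ _ _ _ κ γ I hp3 hgood hap hirr hns hκ hγ hs
  exact h W p κ γ I (by omega) hgood hap hirr hns hκ hγ hs

/-- **`CoreTheoremAOddPrime ⟹` the registered `stub_coreX9` of crux `MuTransferX9`, VERBATIM**
(skeleton v4; `ClassX9 W p` gives `5 ≤ p ≠ 2`, good ordinary, `Irr`, `¬Surj`): with the registered
`MuTransferX9_of`, the odd-prime core closes rung K6's deciding crux for row A4.
[cite: Kato2004Asterisque, Thm. 12.6 (p. 222) (shape only)] -/
theorem coreTheoremA_classX9_of_oddPrime (h : CoreTheoremAOddPrime) :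
    ∀ (W : WeierstrassCurve ℚ) [W.IsElliptic] [W.IsGloballyMinimal] (p : ℕ) [Fact p.Prime]
      [ContinuousSMul ℤ_[p] (W.tateModule p)] [Module.Free ℤ_[p] (W.tateModule p)]
      [Module.Finite ℤ_[p] (W.tateModule p)]
      (κ : ZpExtension ℚ p) (γ : absoluteGaloisGroup ℚ) (I : IwasawaH1Data W p κ γ),
      Summit.BirchSwinnertonDyer.BirchSwinnertonDyer.Rank1Residual.ClassX9 W p →
      κ.IsCyclotomic → κ.IsTopGenerator γ →
      (∃ s : I.H, IsEulerSystemClass W p κ γ I s ∧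
        s ∉ IwasawaAlgebra.augIdealP p • (⊤ : Submodule (IwasawaAlgebra p) I.H)) →
      ∃ J : ℕ, ∀ y : Literature.NumberTheory.EllipticCurves.subgroupH1 κ.kerSubgroup
          (WeierstrassCurve.geomTorsion W (p : ℤ)),
        W.torsionToPrimaryH1Sub p κ.kerSubgroup y ∈ W.fineSelmerInfty κ →
          (⇑(Literature.NumberTheory.EllipticCurves.conjH1 κ.kerSubgroup
              (WeierstrassCurve.geomTorsion W (p : ℤ)) γ -
            AddMonoidHom.id (Literature.NumberTheory.EllipticCurves.subgroupH1 κ.kerSubgroup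
              (WeierstrassCurve.geomTorsion W (p : ℤ)))))^[J] y = 0 := by
  intro W _ _ p _ _ _ _ κ γ I hX9 hκ hγ hs
  obtain ⟨-, h5, hgood, hap, hirr, hns⟩ := hX9
  exact h W p κ γ I (by omega) hgood hap hirr hns hκ hγ hs

/-! ### §3 The composition, once for every odd prime; the N2 node and the A5 chain -/

/-- **KERNEL, every odd prime: Kato's two construction facts ∧ `CoreTheoremAOddPrime` ⟹
`μ(X(E/ℚ_∞)) = 0`** for every cyclotomic Selmer dual datum at a good ordinary `p ≠ 2` with `Irr`,
`¬Surj` and one unit coefficient of `L_p(f, α)` — the registered composition `MuTransferX9_of`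
(skeleton v4) with the class hypothesis replaced by its four used conjuncts: GV Prop. 3.7 → `G₁ ∉ (p)`
→ Kato's package + fine quotient + Thm. 12.6 span clause → a genuine Euler-system class `∉ p𝐇¹` →
the core → `Sel₀[p]` finite → `X₀/pX₀` finite → `length_(p) X₀ = 0 = length_(p) X` → `D.mu = 0`.
[cite: Kato2004Asterisque, Thm. 12.6 (p. 222), (14.9.3) (p. 240) and §17.13 (pp. 279–280)]
[cite: GreenbergVatsal2000, Prop. 3.7] -/
theorem mu_eq_zero_of_coreOddPrime (hne : nonempty_iwasawaH1Data)
    (hfine : exists_divisibilityInputs_fineQuotient_zeta) (hcore : CoreTheoremAOddPrime) :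
    ∀ (W : WeierstrassCurve ℚ) [W.IsElliptic] [W.IsGloballyMinimal] (p : ℕ) [Fact p.Prime]
      {N : ℕ} [NeZero N] (f : CuspForm (Gamma0 N) 2),
      p ≠ 2 → W.HasGoodReductionAtPrime p → ¬ (p : ℤ) ∣ W.frobeniusTrace p →
      W.HasIrreducibleModPGaloisRep p → ¬ W.HasSurjectiveModNGaloisRep p → IsNewformOf W f →
      (∃ n : ℕ, ‖PowerSeries.coeff n (padicLFunction f (unitRoot W p : ℚ_[p]))‖ = 1) →
      ∀ (κ : ZpExtension ℚ p) (γ : absoluteGaloisGroup ℚ),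
        κ.IsCyclotomic → κ.IsTopGenerator γ → IsCyclotomicVariable p γ →
        ∀ D : W.SelmerDualData κ γ, D.mu = 0 := by
  intro W _ _ p _ N _ f hp2 hgood hap hirr hnsurj hf hcert κ γ hκ hγ hγ' D
  haveI : ContinuousSMul ℤ_[p] (W.tateModule p) := TateModule.continuousSMul_padicInt
  haveI : Module.Free ℤ_[p] (W.tateModule p) := W.module_free_tateModule_holds p
  haveI : Module.Finite ℤ_[p] (W.tateModule p) := W.module_finite_tateModule_holds p
  have hord : IsOrdinaryAt W p := ⟨hgood, hap⟩
  -- the pinned modules: `𝐇¹_Γ(T_pW)` and the dual fine Selmer group `X₀(E/ℚ_∞)`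
  obtain ⟨I⟩ := hne W p κ γ hκ hγ
  obtain ⟨Y⟩ := W.nonempty_fineSelmerDualData κ hγ
  -- `X(E/ℚ_∞)` is finitely generated over `Λ` for the cyclotomic `κ` (PROVED in the tree, Nakayama)
  haveI : Module.Finite (IwasawaAlgebra p) D.X :=
    WeierstrassCurve.SelmerDualData.module_finite_of_isCyclotomic W κ hκ D hγ
  -- Kato's package with the fine quotient and the span clause
  obtain ⟨K, π, hπs, hπ, hZ⟩ := hfine W p f κ γ hp2 hord hκ hγ hγ' hf I D Y
  haveI : Module.Finite (IwasawaAlgebra p) Y.X := Module.Finite.of_surjective π hπs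
  -- `L_p ∈ Λ` (GV Prop. 3.7) and the certificate: `G₁ ∉ (p)`
  obtain ⟨G₁, hG₁⟩ := exists_iwasawaToPowerSeries_eq_padicLFunction hp2 hord hf hirr
  have hμL : G₁ ∉ IwasawaAlgebra.augIdealP p := not_mem_augIdealP_of_norm_coeff_eq_one hG₁ hcert
  -- §6 (i) with the Thm. 12.6 span clause: some GENUINE Euler-system class is not divisible by `p`
  obtain ⟨s, hs, hsp⟩ := exists_isEulerSystemClass_not_mem K hZ hirr hG₁ hμL
  -- the core (typed, odd prime): a power of `T` kills the `E[p]`-lifts of `Sel₀`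
  obtain ⟨J, hJ⟩ := hcore W p κ γ I hp2 hgood hap hirr hnsurj hκ hγ ⟨s, hs, hsp⟩
  haveI : Finite (Y.X ⧸ (IwasawaAlgebra.augIdealP p • (⊤ : Submodule (IwasawaAlgebra p) Y.X))) :=
    Y.finite_quotient_augIdealP_of_finite_pTorsion
      (W.finite_fineSelmerInfty_pTorsion_of_forall_iterate_eq_zero κ hγ hJ)
  -- bookkeeping at `𝔭 = (p)`: `length X₀_𝔭 = 0 ⟹ length X_𝔭 = 0 ⟹ μ(X) = 0`
  let 𝔭 : PrimeSpectrum (IwasawaAlgebra p) :=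
    ⟨IwasawaAlgebra.augIdealP p, IwasawaAlgebra.isPrime_augIdealP_holds p⟩
  have hY0 : Module.lengthAt (IwasawaAlgebra p) Y.X 𝔭 = 0 :=
    Summit.BirchSwinnertonDyer.BirchSwinnertonDyer.Rank1Residual.KatoMuSkeleton.lengthAt_eq_zero_of_finite_quotient_p
      (M := Y.X) 𝔭 rfl
  have hX0 : Module.lengthAt (IwasawaAlgebra p) D.X 𝔭 = 0 :=
    le_antisymm ((lengthAt_X_le_lengthAt_fine K hirr hG₁ 𝔭
      (by exact IwasawaAlgebra.height_augIdealP_holds p) hμL π hπ).trans hY0.le) bot_le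
  change muInvariant p D.X = 0
  rw [muInvariant_eq_toNat_lengthAt p D.X 𝔭 rfl, hX0]
  rfl

/-- **The crux statement of `MuTransferX9` (route `SmallImageMuTransfer`, item 19276) on class X9,
VERBATIM, from Kato's two construction facts and the odd-prime core** (`ClassX9 ⟹ 5 ≤ p ≠ 2`).
[cite: Kato2004Asterisque, Thm. 12.6 (p. 222) and §17.13 (pp. 279–280)] [cite: GreenbergVatsal2000, Prop. 3.7] -/
theorem muTransfer_classX9_of_coreOddPrime (hne : nonempty_iwasawaH1Data)
    (hfine : exists_divisibilityInputs_fineQuotient_zeta) (hcore : CoreTheoremAOddPrime) :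
    ∀ (W : WeierstrassCurve ℚ) [W.IsElliptic] [W.IsGloballyMinimal] (p : ℕ) [Fact p.Prime]
      {N : ℕ} [NeZero N] (f : CuspForm (Gamma0 N) 2),
      Summit.BirchSwinnertonDyer.BirchSwinnertonDyer.Rank1Residual.ClassX9 W p →
      IsNewformOf W f →
      (∃ n : ℕ, ‖PowerSeries.coeff n (padicLFunction f (unitRoot W p : ℚ_[p]))‖ = 1) →
      ∀ (κ : ZpExtension ℚ p) (γ : absoluteGaloisGroup ℚ),
        κ.IsCyclotomic → κ.IsTopGenerator γ → IsCyclotomicVariable p γ →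
        ∀ D : W.SelmerDualData κ γ, D.mu = 0 := by
  intro W _ _ p _ N _ f hX9 hf hcert κ γ hκ hγ hγ' D
  obtain ⟨-, h5, hgood, hap, hirr, hns⟩ := hX9
  exact mu_eq_zero_of_coreOddPrime hne hfine hcore W p f (by omega) hgood hap hirr hns hf hcert
    κ γ hκ hγ hγ' D

/-- **N2: `KatoMuTransferThree` from Kato's two construction facts and the odd-prime core** (GEN 36's
`katoMuTransferThree_of_core` ∘ `coreTheoremAOnClassX10b_of_oddPrime`).
[cite: Kato2004Asterisque, Thm. 12.6 (p. 222) and §17.13 (pp. 279–280)] [cite: GreenbergVatsal2000, Prop. 3.7] -/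
theorem katoMuTransferThree_of_coreOddPrime (hne : nonempty_iwasawaH1Data)
    (hfine : exists_divisibilityInputs_fineQuotient_zeta) (hcore : CoreTheoremAOddPrime) :
    KatoMuTransferThree :=
  katoMuTransferThree_of_core hne hfine (coreTheoremAOnClassX10b_of_oddPrime hcore)

/-- **X_A3 on class X10b from the odd-prime core** (GEN 36's `mazurMainConjectureOnClassX10b_of_core`
re-based; Yan–Zhu 4.9 `hYZ` flagged `YZ26@3-BF-ERL-Ohta` rides with the conclusion; nothing booked).
[cite: YanZhu2024MainConjNonCM, Thm. 4.9 (§4.4)] [cite: Kato2004Asterisque, Thm. 12.6 (p. 222) and §17.13 (pp. 279–280)] -/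
theorem mazurMainConjectureOnClassX10b_of_coreOddPrime
    (hYZ : YanZhu2026.thm49_charIdeal_eq_padicLFunction)
    (h5 : realPeriodRat_eq_unit_mul_plusPeriod) (h3 : realPeriodRat_eq_unit_mul_plusPeriod_three)
    (hmodP : nonempty_modularParametrizationData)
    (hne : nonempty_iwasawaH1Data) (hfine : exists_divisibilityInputs_fineQuotient_zeta)
    (hcore : CoreTheoremAOddPrime) (hA : AnalyticMuZeroOnClassX10b) :
    MazurMainConjectureOnClassX10b :=
  mazurMainConjectureOnClassX10b_of_core hYZ h5 h3 hmodP hne hfine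
    (coreTheoremAOnClassX10b_of_oddPrime hcore) hA

/-- **The A5 class leaf from the odd-prime core** (GEN 36's `bsdpOnClassX10b_of_core` re-based: the
K6′ composition in waiting now shares its ONE open core with K6's crux `MuTransferX9`): PUBLISHED
binders (Yan–Zhu 4.9 flagged, Greenberg 4.1, period units, PR–Schneider / PR 1987 / Mazur–Tate, modularity,
GZK), Kato's two CONSTRUCTION facts, the OPEN `CoreTheoremAOddPrime` and `AnalyticMuZeroOnClassX10b`
(barrier B3), the Schneider rider at rank `1` ⟹ `BSDpOnClassX10b`. Nothing booked.
[cite: YanZhu2024MainConjNonCM, Thm. 4.9 (§4.4)] [cite: GreenbergLNM1716, Thm. 4.1 (p. 102) and §1 Conj. 1.11]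
[cite: Kato2004Asterisque, Thm. 12.6 (p. 222) and §17.13 (pp. 279–280)] [cite: Miller2011LMS, §1 and Def. 1.1] -/
theorem bsdpOnClassX10b_of_coreOddPrime
    (hYZ : YanZhu2026.thm49_charIdeal_eq_padicLFunction)
    (hGr : greenberg_charValue_rankZero) (h5 : realPeriodRat_eq_unit_mul_plusPeriod)
    (h3 : realPeriodRat_eq_unit_mul_plusPeriod_three)
    (hS : Schneider1985_order_charGenerator_odd) (hPR : perrinRiou_rankOne_leadingTerms_odd)
    (hMT : mazur_tate_sigma_exists_odd) (hmodP : nonempty_modularParametrizationData)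
    (hGZK : rank_eq_analyticRank_of_analyticRank_le_one)
    (hne : nonempty_iwasawaH1Data) (hfine : exists_divisibilityInputs_fineQuotient_zeta)
    (hcore : CoreTheoremAOddPrime) (hA : AnalyticMuZeroOnClassX10b)
    (hC3 : ∀ (W : WeierstrassCurve ℚ) [W.IsElliptic] [W.IsGloballyMinimal] (p : ℕ) [Fact p.Prime],
      ClassX10 W p → ¬ Surj W 3 → W.analyticRank = 1 →
        ∀ Dh : PAdicHeightData W p, Dh.IsCanonical → SchneiderConjecture Dh) :
    BSDpOnClassX10b :=
  bsdpOnClassX10b_of_core hYZ hGr h5 h3 hS hPR hMT hmodP hGZK hne hfine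
    (coreTheoremAOnClassX10b_of_oddPrime hcore) hA hC3

end Summit.BirchSwinnertonDyer.Rank1Residual.X10

end
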